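import Summits.AnomalousDissipation.AnomalousDissipation.Theorems.SawtoothPulseCascadeK1LocalisedCascadeLedgerClassEnergyChain

/-!
# K1loc, line `Spectral` / thin start — helper: THE CLASS CHAIN WITH THE FEEDS RESOLVED (per-phase energy increment in closed form)

Helper file of the prover lane on the crux `K1LocalisedCascade` (stmt-AnomalousDissipation-19491), route `SawtoothPulseCascade`
(S-B/S-C assembly seat; the LEDGER ASSEMBLY, abstract layer — last glue).  `…LedgerClassEnergyChain` turns (S-V)+(T-H)+(O-V) into
`E_{j+1} ≤ E_j + e_j` with the two shallow FEEDS `P¹_j = C_j(Y₁)`, `P²_j = C_j(Y₂)` left inside `e_j`; the feeds are themselves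
windows, (C-H) `C_j(Y) ≤ (w^C + √A_j(Y′))² + f^C`, and the shell class `A_j(Y′)` is bounded through `sqrt_le_escalate_cap_of_floor`
(`…LedgerClassChain`; `κ = 1` allowed: a few phases back the threshold is in the far tail) by an AMPLITUDE `𝔞_j`.  This file
substitutes all of that and records the per-phase increment in closed form:
  `e_j = w^T_j² + 2w^T_j·o_j + (w^S_j + w^{C1}_j + 𝔞¹_j + √f^{C1}_j)² + (w^O_j + w^{C2}_j + 𝔞²_j + √f^{C2}_j)² + f^S_j + f^T_j + f^O_j`
(`o_j ≥ √O_j`, e.g. `o_j = w^O_{j−1} + w^{C2}_{j−1} + 𝔞²_{j−1} + √f^{C2}_{j−1} + √f^O_{j−1}` for `j > j₀`, `o_{j₀} = √O_{j₀}`), and the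
closer `k1Localised_of_resolved_ledger` (= `k1Localised_of_energy_ledger` on `E = S + O`).  After this, the numeric layer only
has to bound the junk AMPLITUDES `w`, the cap amplitudes `𝔞` and the far terms `f` of the canonical steps (`…CanonicalRatioSteps`,
`…CanonicalStripSteps`) by a geometric sequence.  Pure real bookkeeping; no definitions; nothing about `δ₀ = ¼`.
[cite: DEIJ2022, (1.2)–(1.3)] [cite: ElgindiLissMattingly2025, §1.2.2 and §3.1] [cite: Grafakos2014, Prop. 3.2.7 (3)] [problem: turb]
-/

-- `Summit.<Summit>.<Problem>`: single-conjunct summit, the duplicate namespace segment is deliberate.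
set_option linter.dupNamespace false

noncomputable section

namespace Summit.AnomalousDissipation.AnomalousDissipation.Theorems.SawtoothPulseCascade.K1Ledger.From

open MeasureTheory Set Filter Topology UnitAddTorus Function
open scoped ENNReal
open Literature.Analysis Literature.Analysis.FunctionSpaces Literature.Analysis.FunctionSpaces.Torus Literature.Analysis.FluidPDE
open Literature.Analysis.FluidPDE.ShearStage
open Literature.Analysis.FluidPDE.SawtoothCascade Literature.Analysis.FluidPDE.SawtoothCascade.CascadeParams
open Summit.AnomalousDissipation.AnomalousDissipation.Theorems.SawtoothPulseCascade.K1Window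

/-! ## §1 One phase with the feeds resolved -/

/-- **A window with a resolved feed**: `x ≤ (w + √C)² + f` and `√C ≤ c` (`w, c ≥ 0`) give `x ≤ (w + c)² + f`. [folklore] -/
theorem le_sq_add_of_sqrt_feed_le {x w C c f : ℝ} (h : x ≤ (w + Real.sqrt C) ^ 2 + f) (hw : 0 ≤ w) (hc : Real.sqrt C ≤ c) :
    x ≤ (w + c) ^ 2 + f :=
  h.trans (add_le_add (pow_le_pow_left₀ (add_nonneg hw (Real.sqrt_nonneg _)) (add_le_add le_rfl hc) 2) le_rfl)

/-- **A feed through its own window**: (C-H) `C ≤ (w^C + √A)² + f^C` with `√A ≤ 𝔞` (`w^C, 𝔞, f^C ≥ 0`, `A ≥ 0`) gives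
`√C ≤ w^C + 𝔞 + √f^C`. [folklore] -/
theorem sqrt_feed_le_of_window {C wC A 𝔞 fC : ℝ} (h : C ≤ (wC + Real.sqrt A) ^ 2 + fC) (hwC : 0 ≤ wC) (hA : 0 ≤ A)
    (hfC : 0 ≤ fC) (h𝔞 : Real.sqrt A ≤ 𝔞) : Real.sqrt C ≤ wC + 𝔞 + Real.sqrt fC := by
  have := sqrt_le_add_sqrt_add_sqrt_of_le h hwC hA hfC
  linarith

/-- **THE TRACKED-PAIR STEP WITH RESOLVED FEEDS, ENERGY FORM.**  Inputs at one phase: (S-V) `S' ≤ T + (w^S + √C₁)² + f^S`,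
(T-H) `T ≤ S + (w^T + √O)² + f^T`, (O-V) `O' ≤ (w^O + √C₂)² + f^O`, the two feed windows (C-H)
`C_i ≤ (w^{Ci} + √A_i)² + f^{Ci}` with cap amplitudes `√A_i ≤ 𝔞_i`, and an amplitude bound `√O ≤ o` for the tracked off-cone class.
Output: `S' + O' ≤ S + O + (w^T² + 2w^T·o + (w^S + w^{C1} + 𝔞₁ + √f^{C1})² + (w^O + w^{C2} + 𝔞₂ + √f^{C2})² + f^S + f^T + f^O)`.
[folklore] -/
theorem strip_offCone_resolved_step {S T O S' O' C₁ C₂ A₁ A₂ wS wT wO wC₁ wC₂ 𝔞₁ 𝔞₂ o fS fT fO fC₁ fC₂ : ℝ}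
    (h1 : S' ≤ T + (wS + Real.sqrt C₁) ^ 2 + fS) (h2 : T ≤ S + (wT + Real.sqrt O) ^ 2 + fT)
    (h3 : O' ≤ (wO + Real.sqrt C₂) ^ 2 + fO)
    (h4 : C₁ ≤ (wC₁ + Real.sqrt A₁) ^ 2 + fC₁) (h5 : C₂ ≤ (wC₂ + Real.sqrt A₂) ^ 2 + fC₂)
    (h𝔞₁ : Real.sqrt A₁ ≤ 𝔞₁) (h𝔞₂ : Real.sqrt A₂ ≤ 𝔞₂) (ho : Real.sqrt O ≤ o)
    (hO : 0 ≤ O) (hA₁ : 0 ≤ A₁) (hA₂ : 0 ≤ A₂) (hwS : 0 ≤ wS) (hwT : 0 ≤ wT) (hwO : 0 ≤ wO) (hwC₁ : 0 ≤ wC₁)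
    (hwC₂ : 0 ≤ wC₂) (hfC₁ : 0 ≤ fC₁) (hfC₂ : 0 ≤ fC₂) :
    S' + O' ≤ S + O + (wT ^ 2 + 2 * wT * o + (wS + wC₁ + 𝔞₁ + Real.sqrt fC₁) ^ 2 + (wO + wC₂ + 𝔞₂ + Real.sqrt fC₂) ^ 2 +
      fS + fT + fO) := by
  have hc₁ : Real.sqrt C₁ ≤ wC₁ + 𝔞₁ + Real.sqrt fC₁ := sqrt_feed_le_of_window h4 hwC₁ hA₁ hfC₁ h𝔞₁
  have hc₂ : Real.sqrt C₂ ≤ wC₂ + 𝔞₂ + Real.sqrt fC₂ := sqrt_feed_le_of_window h5 hwC₂ hA₂ hfC₂ h𝔞₂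
  have h1' : S' ≤ T + (wS + (wC₁ + 𝔞₁ + Real.sqrt fC₁)) ^ 2 + fS := by
    have h1s : S' - T ≤ (wS + Real.sqrt C₁) ^ 2 + fS := by linarith
    have := le_sq_add_of_sqrt_feed_le h1s hwS hc₁
    linarith
  have h3' : O' ≤ (wO + (wC₂ + 𝔞₂ + Real.sqrt fC₂)) ^ 2 + fO := le_sq_add_of_sqrt_feed_le h3 hwO hc₂
  have e : (wT + Real.sqrt O) ^ 2 = wT ^ 2 + 2 * wT * Real.sqrt O + O := by rw [add_sq, Real.sq_sqrt hO]
  have h2' : T ≤ S + (wT ^ 2 + 2 * wT * o + O) + fT := by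
    have : 2 * wT * Real.sqrt O ≤ 2 * wT * o := mul_le_mul_of_nonneg_left ho (by linarith)
    linarith
  have ea : (wS + (wC₁ + 𝔞₁ + Real.sqrt fC₁)) ^ 2 = (wS + wC₁ + 𝔞₁ + Real.sqrt fC₁) ^ 2 := by ring
  have eb : (wO + (wC₂ + 𝔞₂ + Real.sqrt fC₂)) ^ 2 = (wO + wC₂ + 𝔞₂ + Real.sqrt fC₂) ^ 2 := by ring
  rw [ea] at h1'
  rw [eb] at h3'
  linarith

/-- **The resolved ledger along the phases**: with all data as sequences and the hypotheses of `strip_offCone_resolved_step` for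
`j ≥ j₀`, `E_{j+1} ≤ E_j + e_j` (`E = S + O`) with the closed-form increment of the file header. [folklore] -/
theorem strip_offCone_resolved_ledger {S T O C₁ C₂ A₁ A₂ wS wT wO wC₁ wC₂ 𝔞₁ 𝔞₂ o fS fT fO fC₁ fC₂ : ℕ → ℝ} {j₀ : ℕ}
    (h1 : ∀ j, j₀ ≤ j → S (j + 1) ≤ T j + (wS j + Real.sqrt (C₁ j)) ^ 2 + fS j)
    (h2 : ∀ j, j₀ ≤ j → T j ≤ S j + (wT j + Real.sqrt (O j)) ^ 2 + fT j)
    (h3 : ∀ j, j₀ ≤ j → O (j + 1) ≤ (wO j + Real.sqrt (C₂ j)) ^ 2 + fO j)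
    (h4 : ∀ j, j₀ ≤ j → C₁ j ≤ (wC₁ j + Real.sqrt (A₁ j)) ^ 2 + fC₁ j)
    (h5 : ∀ j, j₀ ≤ j → C₂ j ≤ (wC₂ j + Real.sqrt (A₂ j)) ^ 2 + fC₂ j)
    (h𝔞₁ : ∀ j, j₀ ≤ j → Real.sqrt (A₁ j) ≤ 𝔞₁ j) (h𝔞₂ : ∀ j, j₀ ≤ j → Real.sqrt (A₂ j) ≤ 𝔞₂ j)
    (ho : ∀ j, j₀ ≤ j → Real.sqrt (O j) ≤ o j)
    (hO : ∀ j, 0 ≤ O j) (hA₁ : ∀ j, 0 ≤ A₁ j) (hA₂ : ∀ j, 0 ≤ A₂ j) (hwS : ∀ j, 0 ≤ wS j) (hwT : ∀ j, 0 ≤ wT j)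
    (hwO : ∀ j, 0 ≤ wO j) (hwC₁ : ∀ j, 0 ≤ wC₁ j) (hwC₂ : ∀ j, 0 ≤ wC₂ j) (hfC₁ : ∀ j, 0 ≤ fC₁ j) (hfC₂ : ∀ j, 0 ≤ fC₂ j) :
    ∀ j, j₀ ≤ j → S (j + 1) + O (j + 1) ≤ S j + O j +
      (wT j ^ 2 + 2 * wT j * o j + (wS j + wC₁ j + 𝔞₁ j + Real.sqrt (fC₁ j)) ^ 2 +
        (wO j + wC₂ j + 𝔞₂ j + Real.sqrt (fC₂ j)) ^ 2 + fS j + fT j + fO j) :=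
  fun j hj => strip_offCone_resolved_step (h1 j hj) (h2 j hj) (h3 j hj) (h4 j hj) (h5 j hj) (h𝔞₁ j hj) (h𝔞₂ j hj) (ho j hj)
    (hO j) (hA₁ j) (hA₂ j) (hwS j) (hwT j) (hwO j) (hwC₁ j) (hwC₂ j) (hfC₁ j) (hfC₂ j)

/-- **The off-cone amplitude for the next phase**: (O-V) + (C-H) + cap give `√O' ≤ w^O + w^{C2} + 𝔞₂ + √f^{C2} + √f^O` — the
choice of `o_{j+1}` in `strip_offCone_resolved_ledger`. [folklore] -/
theorem sqrt_offCone_next_le {O' C₂ A₂ wO wC₂ 𝔞₂ fO fC₂ : ℝ} (h3 : O' ≤ (wO + Real.sqrt C₂) ^ 2 + fO)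
    (h5 : C₂ ≤ (wC₂ + Real.sqrt A₂) ^ 2 + fC₂) (h𝔞₂ : Real.sqrt A₂ ≤ 𝔞₂) (hA₂ : 0 ≤ A₂) (hwO : 0 ≤ wO) (hwC₂ : 0 ≤ wC₂)
    (hfO : 0 ≤ fO) (hfC₂ : 0 ≤ fC₂) : Real.sqrt O' ≤ wO + wC₂ + 𝔞₂ + Real.sqrt fC₂ + Real.sqrt fO := by
  have hc₂ : Real.sqrt C₂ ≤ wC₂ + 𝔞₂ + Real.sqrt fC₂ := sqrt_feed_le_of_window h5 hwC₂ hA₂ hfC₂ h𝔞₂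
  have hc0 : 0 ≤ wC₂ + 𝔞₂ + Real.sqrt fC₂ := (Real.sqrt_nonneg _).trans hc₂
  have h3' : O' ≤ (wO + (wC₂ + 𝔞₂ + Real.sqrt fC₂)) ^ 2 + fO := le_sq_add_of_sqrt_feed_le h3 hwO hc₂
  have := sqrt_le_add_sqrt_add_sqrt_of_le (z := (wC₂ + 𝔞₂ + Real.sqrt fC₂) ^ 2) (u := wO) (f := fO) (x := O')
    (by rwa [Real.sqrt_sq hc0]) hwO (sq_nonneg _) hfO
  rw [Real.sqrt_sq hc0] at this
  linarith

/-! ## §2 The closer with resolved feeds -/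

section Cascade

variable (P : CascadeParams)

/-- **`K1Localised P (γ² − 3)` from the RESOLVED class ledger** (shape P, `L_min ≥ 1000`): the data of
`k1Localised_of_class_energy_ledger` with the two feeds replaced by their windows (C-H) and cap amplitudes `𝔞₁, 𝔞₂` (from
`sqrt_le_escalate_cap_of_floor`), an off-cone amplitude sequence `o ≥ √O` (from `sqrt_offCone_next_le` and the start), summable
increments `e_j` (file header) and the budget `S_{j₀} + O_{j₀} + Σ'_i e_{j₀+i} < ‖datum‖²`.  Then `K1Localised P (γ² − 3)`.
[cite: DEIJ2022, (1.2)–(1.3)] [cite: ElgindiLissMattingly2025, §1.2.2 and §3.1] [cite: Grafakos2014, Prop. 3.2.7 (3)] -/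
theorem k1Localised_of_resolved_ledger (hγ : 5 ≤ P.γ) (hγ' : P.γ ≤ 8) (hδ₀ : 0 < P.δ₀)
    (hδ₀' : P.δ₀ ≤ 1 / 4) (hd : P.d = 2) (hN₀ : P.N₀ = 1) (hρN : P.ρN = 2) {Lm : ℝ} (hLm : 1000 ≤ Lm)
    (a b : ℕ → UnitAddTorus (Fin 2) → ℝ) (has : ∀ j, IsSmooth (a j)) (h0 : a 0 = datum)
    (hb : ∀ j, b j = a j ∘ shearMap 0 1 (amp ⟨P.U j, P.U_periodic j, P.contDiff_U (P.δ_pos hδ₀ (by rw [hd]; norm_num) j)⟩ P.γ))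
    (hab : ∀ j, a (j + 1) = b j ∘ shearMap 1 0 (amp ⟨P.U j, P.U_periodic j, P.contDiff_U (P.δ_pos hδ₀ (by rw [hd]; norm_num) j)⟩ P.γ))
    (K : ℕ → ℕ) {c : ℝ} (hc : 0 < c) {u v : ℕ} (huv : (u : ℝ) * P.γ ≤ 13 / 10 * v)
    (S T O C₁ C₂ A₁ A₂ wS wT wO wC₁ wC₂ 𝔞₁ 𝔞₂ o fS fT fO fC₁ fC₂ : ℕ → ℝ) {j₁ j₀ : ℕ}
    (hcK : ∀ n, j₁ ≤ n → (1 + 1 / 250) * (c * (P.γ ^ 2 - 3) ^ n) ≤ K n)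
    (hSn : ∀ n, j₁ ≤ n → ∑' k : Fin 2 → ℤ, (if |k 0| < (K n : ℤ) then (1 : ℝ) else 0) *
        ‖mFourierCoeff (fun x => (a n x : ℂ)) k‖ ^ 2 ≤ S n)
    (hOn : ∀ n, j₁ ≤ n → ∑' k : Fin 2 → ℤ, (if (K n : ℤ) ≤ |k 0| ∧ (u : ℤ) * |k 0| ≤ (v : ℤ) * |k 1| then (1 : ℝ) else 0) *
        ‖mFourierCoeff (fun x => (a n x : ℂ)) k‖ ^ 2 ≤ O n)
    (h1 : ∀ j, j₀ ≤ j → S (j + 1) ≤ T j + (wS j + Real.sqrt (C₁ j)) ^ 2 + fS j)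
    (h2 : ∀ j, j₀ ≤ j → T j ≤ S j + (wT j + Real.sqrt (O j)) ^ 2 + fT j)
    (h3 : ∀ j, j₀ ≤ j → O (j + 1) ≤ (wO j + Real.sqrt (C₂ j)) ^ 2 + fO j)
    (h4 : ∀ j, j₀ ≤ j → C₁ j ≤ (wC₁ j + Real.sqrt (A₁ j)) ^ 2 + fC₁ j)
    (h5 : ∀ j, j₀ ≤ j → C₂ j ≤ (wC₂ j + Real.sqrt (A₂ j)) ^ 2 + fC₂ j)
    (h𝔞₁ : ∀ j, j₀ ≤ j → Real.sqrt (A₁ j) ≤ 𝔞₁ j) (h𝔞₂ : ∀ j, j₀ ≤ j → Real.sqrt (A₂ j) ≤ 𝔞₂ j)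
    (ho : ∀ j, j₀ ≤ j → Real.sqrt (O j) ≤ o j)
    (hO : ∀ j, 0 ≤ O j) (hA₁ : ∀ j, 0 ≤ A₁ j) (hA₂ : ∀ j, 0 ≤ A₂ j) (hwS : ∀ j, 0 ≤ wS j) (hwT : ∀ j, 0 ≤ wT j)
    (hwO : ∀ j, 0 ≤ wO j) (hwC₁ : ∀ j, 0 ≤ wC₁ j) (hwC₂ : ∀ j, 0 ≤ wC₂ j) (ho0 : ∀ j, 0 ≤ o j) (hfS : ∀ j, 0 ≤ fS j) (hfT : ∀ j, 0 ≤ fT j) (hfO : ∀ j, 0 ≤ fO j) (hfC₁ : ∀ j, 0 ≤ fC₁ j)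
    (hfC₂ : ∀ j, 0 ≤ fC₂ j)
    (hes : Summable fun j => wT j ^ 2 + 2 * wT j * o j + (wS j + wC₁ j + 𝔞₁ j + Real.sqrt (fC₁ j)) ^ 2 +
        (wO j + wC₂ j + 𝔞₂ j + Real.sqrt (fC₂ j)) ^ 2 + fS j + fT j + fO j)
    (hbudget : S j₀ + O j₀ + ∑' i, (wT (j₀ + i) ^ 2 + 2 * wT (j₀ + i) * o (j₀ + i) +
        (wS (j₀ + i) + wC₁ (j₀ + i) + 𝔞₁ (j₀ + i) + Real.sqrt (fC₁ (j₀ + i))) ^ 2 +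
        (wO (j₀ + i) + wC₂ (j₀ + i) + 𝔞₂ (j₀ + i) + Real.sqrt (fC₂ (j₀ + i))) ^ 2 +
        fS (j₀ + i) + fT (j₀ + i) + fO (j₀ + i)) < Torus.scalarL2Sq datum) :
    K1Localised P (P.γ ^ 2 - 3) := by
  have hγ0 : 0 < P.γ := by linarith
  refine k1Localised_of_energy_ledger P hγ hγ' hδ₀ hδ₀' hd hN₀ hρN hLm a b has h0 hb hab hc (fun n => S n + O n)
    (fun j => wT j ^ 2 + 2 * wT j * o j + (wS j + wC₁ j + 𝔞₁ j + Real.sqrt (fC₁ j)) ^ 2 +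
      (wO j + wC₂ j + 𝔞₂ j + Real.sqrt (fC₂ j)) ^ 2 + fS j + fT j + fO j)
    (i₁ := j₁) (j₀ := j₀) (fun n hn => ?_)
    (strip_offCone_resolved_ledger h1 h2 h3 h4 h5 h𝔞₁ h𝔞₂ ho hO hA₁ hA₂ hwS hwT hwO hwC₁ hwC₂ hfC₁ hfC₂)
    (fun j => by
      have h2' : 0 ≤ 2 * wT j * o j := by have := hwT j; have := ho0 j; positivity
      linarith [sq_nonneg (wT j), sq_nonneg (wS j + wC₁ j + 𝔞₁ j + Real.sqrt (fC₁ j)),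
        sq_nonneg (wO j + wC₂ j + 𝔞₂ j + Real.sqrt (fC₂ j)), hfS j, hfT j, hfO j])
    hes hbudget
  -- domination of the two thin channels (as in `k1Localised_of_class_energy_ledger`)
  set cf : (Fin 2 → ℤ) → ℝ := fun k => ‖mFourierCoeff (fun x => (a n x : ℂ)) k‖ ^ 2 with hcf
  have hcs : Summable cf := (SpectralLeakage.hasSum_sq_norm_mFourierCoeff_scalarL2Sq (has n).continuous).summable
  have hc0 : ∀ k, 0 ≤ cf k := fun k => sq_nonneg _
  have hI : ∀ (p : (Fin 2 → ℤ) → Prop) [DecidablePred p], Summable fun k => (if p k then (1 : ℝ) else 0) * cf k := by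
    intro p _
    refine Summable.of_nonneg_of_le (fun k => mul_nonneg (by split_ifs <;> norm_num) (hc0 k)) (fun k => ?_) hcs
    exact mul_le_of_le_one_left (hc0 k) (by split_ifs <;> norm_num)
  have hdom := tsum_lowBand_offCone_le hcs hc0 (fun k : Fin 2 → ℤ => ((k 0 : ℤ) : ℝ))
    (fun k : Fin 2 → ℤ => 13 / 10 * |((k 0 : ℤ) : ℝ)| < P.γ * |((k 1 : ℤ) : ℝ)|) (hcK n hn)
  refine hdom.trans (add_le_add ?_ ?_)
  · refine le_of_eq_of_le (tsum_congr fun k => ?_) (hSn n hn)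
    rw [indicator_abs_lt_natCast_eq]
  · refine le_trans ((hI _).tsum_le_tsum (fun k => ?_) (hI _)) (hOn n hn)
    exact mul_le_mul_of_nonneg_right (indicator_offCone_le_ratioClass hγ0 huv (K n) (k 0) (k 1)) (hc0 k)

end Cascade

end Summit.AnomalousDissipation.AnomalousDissipation.Theorems.SawtoothPulseCascade.K1Ledger.From
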